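import Summits.QuantumFields.YangMills.Theorems.BalabanUVNodesN15KingModelTransferOperatorMassGap
import Summits.QuantumFields.YangMills.Theorems.BalabanUVNodesN15KingModelOSGapLowerBound

/-!
# BalabanUVNodes ∕ N15 — THE KING-MODEL RUNG (PART Ͳ-e₂): THE MASS GAP OF KING's TRANSFER OPERATOR IS EXACTLY `√m²` — `‖T P_{Ω^⊥}‖ = e^{−√m²}`, `massGap = √m²`
# (Track A, DAG node N15 = NE2; FAN-OUT v1.1 §N15 s3 «KING-MODEL RUNG»; count-neutral)

HONEST FRAMING.  Count-neutral (cell `pub-ymgap`, seat `pub-ymgap-dag-n15-e` g36; `--supports stmt-QuantumFields-27366 --as helper` = K3⁸).  King's `A = 0`, `g = 0` model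
([King1986] C. King, Commun. Math. Phys. **102** (1986) 649–677): the FREE massive block field `μ_∞` and its transfer operator (parts Ͳ-c₂∕Ͳ-d₃).  The spectral clustering
estimate of the tree (`TransferData.norm_inner_pow_apply_sub_le`: `|⟪v, T^t v⟫ − ⟪v,Ω⟫⟪Ω,v⟫| ≤ ‖v‖²·gapNorm^t`) applied to `v = ι(e^{iφ(0)})` (`‖v‖² ≤ 1`), against part Ͳ-e₁'s
lower bound `e^{−S₂^{ℝ}(0)}S₂^{ℝ}((t+1)e₀) ≤ |…|` whose `t`-th root tends to `e^{−√m²}`, gives ★★ `e^{−√m²} ≤ gapNorm`; with part Ͳ-d₃: ★★★ **`king_gapNorm_eq : gapNorm = e^{−√m²}`** and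
★★★ **`king_massGap_eq : massGap = √m²`** — the mass gap of the Osterwalder–Schrader transfer operator of King's infinite-volume block field IS EXACTLY the mass `√m²` (the tree's
`EReal`-valued `TransferData.massGap`), and `HasMassGap m′ ↔ 0 < m′ ≤ √m²`.  HONEST: free field; this identifies the OS∕spectral mass with the Euclidean decay rate of `S₂^{ℝ}` (parts Ϸ-r…Ϸ-t)
inside the tree's interfaces; NOT Bałaban's objects; NOT a node discharge; nothing about Yang–Mills ∕ continuum ∕ `ℝ⁴` ∕ Clay.  0 `sorry`, 0 def; standard axioms.

WHAT THIS FILE PROVES (kernel).  `king_norm_rpMap_onePoint_sq_le_one`, ★★ `king_onePoint_lowerBound_le_gapNorm_pow`, ★★ `king_exp_neg_le_gapNorm`, ★★★ **`king_gapNorm_eq`**,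
★★★ **`king_massGap_eq`**, ★★ `king_hasMassGap_iff`.

HONEST SCOPE.  King's free infinite-volume block field (`m² > 0`, every `d`).  N15 untouched; counts unmoved.
Locators (use): [King1986] Thm 2.1 (2.22)–(2.23) p.654, Thm 3.3 (3.6) p.656; Glimm–Jaffe 1987 §6.1 Thm. 6.1.3, §19.7 Thm. 19.7.1; Osterwalder–Seiler 1978 §2.
-/

noncomputable section

open scoped BigOperators Topology ComplexConjugate InnerProductSpace
open Filter MeasureTheory ProbabilityTheory Finset Complex

namespace Summit.QuantumFields.YangMills.BalabanUVNodes.N15KingModelRung.InfiniteVolume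

open Literature.MathematicalPhysics.QuantumFieldTheory (latticeTimeReflection positiveTimeSites positiveTimeEvents latticeTimeShift)
open Literature.Probability.LatticeModels (configReflect IsBoundedMeasurable IsRPMeasureData IsOSRealisation TransferData rpMap rpTransferData rpMap_of_mem osMap
  norm_osMap_sq bddMeasurable)
open Summit.QuantumFields.YangMills.BalabanUVNodes.N15KingModelRung.OptimalDecay
open Summit.QuantumFields.YangMills.BalabanUVNodes.N15KingModelRung.ProperTime

variable {d : ℕ}

/-- `‖ι(e^{iφ(0)})‖² ≤ 1` (OS seminorm ≤ `L²`, `|e^{iφ}| = 1`). [cite: GlimmJaffe1987, §6.1 (6.1.12)] -/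
theorem king_norm_rpMap_onePoint_sq_le_one {m2 : ℝ} (hm : 0 < m2) :
    ‖rpMap (king_isRPMeasureData (d := d) hm) (fun ω : (Fin (d + 1) → ℤ) → ℝ => ∑ k : Fin 1, (fun _ => (1 : ℂ)) k
        * Complex.exp (((∑ z ∈ ({0} : Finset (Fin (d + 1) → ℤ)), (fun (_ : Fin 1) (_ : Fin (d + 1) → ℤ) => (1 : ℝ)) k z * ω z : ℝ) : ℂ) * I))‖ ^ 2 ≤ 1 := by
  have hs : ∀ z ∈ ({0} : Finset (Fin (d + 1) → ℤ)), z ∈ positiveTimeSites (d + 1) := fun z hz => by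
    rw [Finset.mem_singleton] at hz; subst hz
    show (0 : ℤ) ≤ (0 : Fin (d + 1) → ℤ) 0
    simp
  have hF := isBoundedMeasurable_trigPoly (d := d) (fun _ : Fin 1 => (1 : ℂ)) hs (fun _ _ => (1 : ℝ))
  have h0 : IsBoundedMeasurable (positiveTimeEvents (d + 1) ℝ) (0 : ((Fin (d + 1) → ℤ) → ℝ) → ℂ) := (bddMeasurable (positiveTimeEvents (d + 1) ℝ)).zero_mem
  have h := king_norm_rpMap_sub_sq_le (d := d) hm hF h0
  rw [rpMap_of_mem _ h0] at h
  have hz : osMap (king_isRPMeasureData (d := d) hm).core ⟨0, h0⟩ = 0 := by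
    have : (⟨0, h0⟩ : bddMeasurable (positiveTimeEvents (d + 1) ℝ)) = 0 := rfl
    rw [this, map_zero]
  rw [hz, sub_zero] at h
  simp only [Pi.zero_apply, sub_zero] at h
  exact h.trans (integral_normSq_onePoint (d := d) hm).le

/-- ★★ **THE ONE-POINT LOWER BOUND AGAINST THE SPECTRAL BOUND**: `e^{−S₂^{ℝ}(0)}·S₂^{ℝ}((t+1)e₀) ≤ gapNorm^t` for all `t` (part Ͳ-e₁'s lower bound `≤ |truncated pairing| =
|⟪v,T^tv⟫ − ⟪v,Ω⟫⟪Ω,v⟫| ≤ ‖v‖²gapNorm^t ≤ gapNorm^t`). [cite: GlimmJaffe1987, §6.1 Thm. 6.1.3, §19.7; King1986, Thm 2.1 (2.23) p.654] -/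
theorem king_onePoint_lowerBound_le_gapNorm_pow {m2 : ℝ} (hm : 0 < m2) (t : ℕ) :
    Real.exp (-kingS2Inf (d := d) m2 0) * kingS2Inf m2 ((Pi.single 0 1 : Fin (d + 1) → ℤ) + (t : ℤ) • (Pi.single 0 (1 : ℤ) : Fin (d + 1) → ℤ))
      ≤ (rpTransferData (king_isRPMeasureData (d := d) hm) (king_shift_nonneg hm)).gapNorm ^ t := by
  have hOS := king_isOSRealisation (d := d) hm
  have hs : ∀ z ∈ ({0} : Finset (Fin (d + 1) → ℤ)), z ∈ positiveTimeSites (d + 1) := fun z hz => by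
    rw [Finset.mem_singleton] at hz; subst hz
    show (0 : ℤ) ≤ (0 : Fin (d + 1) → ℤ) 0
    simp
  have hF := isBoundedMeasurable_trigPoly (d := d) (fun _ : Fin 1 => (1 : ℂ)) hs (fun _ _ => (1 : ℝ))
  set v := rpMap (king_isRPMeasureData (d := d) hm) (fun ω : (Fin (d + 1) → ℤ) → ℝ => ∑ k : Fin 1, (fun _ => (1 : ℂ)) k
        * Complex.exp (((∑ z ∈ ({0} : Finset (Fin (d + 1) → ℤ)), (fun (_ : Fin 1) (_ : Fin (d + 1) → ℤ) => (1 : ℝ)) k z * ω z : ℝ) : ℂ) * I)) with hv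
  set D := rpTransferData (king_isRPMeasureData (d := d) hm) (king_shift_nonneg hm) with hD
  -- the truncated pairing is the matrix element
  have hid := os_truncated_onePoint_eq (d := d) hm t
  rw [hOS.integral_conj_comp_reflect_mul_comp_iterate hF hF t, hOS.integral_conj_comp_reflect hF, hOS.integral_eq_inner_vacuum hF] at hid
  -- spectral bound and lower bound
  have hspec := D.norm_inner_pow_apply_sub_le v v t
  have hlow := os_truncated_onePoint_norm_ge (d := d) m2 t
  rw [← hid] at hlow
  have hv1 : ‖v‖ * ‖v‖ ≤ 1 := by
    have h := king_norm_rpMap_onePoint_sq_le_one (d := d) hm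
    rw [← hv] at h
    nlinarith [norm_nonneg v]
  have hg0 : 0 ≤ D.gapNorm ^ t := pow_nonneg D.gapNorm_nonneg t
  calc _ ≤ _ := hlow
    _ ≤ ‖v‖ * ‖v‖ * D.gapNorm ^ t := hspec
    _ ≤ 1 * D.gapNorm ^ t := mul_le_mul_of_nonneg_right hv1 hg0
    _ = D.gapNorm ^ t := one_mul _

/-- ★★ **THE GAP IS NOT LARGER THAN THE MASS**: `e^{−√m²} ≤ gapNorm` (take `t`-th roots in `king_onePoint_lowerBound_le_gapNorm_pow` and let `t → ∞` with part Ͳ-e₁'s limit).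
[cite: King1986, Thm 3.3 (3.6) p.656; GlimmJaffe1987, §19.7 Thm. 19.7.1] -/
theorem king_exp_neg_le_gapNorm {m2 : ℝ} (hm : 0 < m2) :
    Real.exp (-Real.sqrt m2) ≤ (rpTransferData (king_isRPMeasureData (d := d) hm) (king_shift_nonneg hm)).gapNorm := by
  set D := rpTransferData (king_isRPMeasureData (d := d) hm) (king_shift_nonneg hm) with hD
  have hlim := tendsto_rpow_onePoint_lowerBound (d := d) hm
  refine le_of_tendsto hlim ?_
  filter_upwards [eventually_ge_atTop 1] with t ht
  have ht0 : (0 : ℝ) < t := by exact_mod_cast ht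
  have ha0 : 0 ≤ Real.exp (-kingS2Inf (d := d) m2 0) * kingS2Inf m2 ((Pi.single 0 1 : Fin (d + 1) → ℤ) + (t : ℤ) • (Pi.single 0 (1 : ℤ) : Fin (d + 1) → ℤ)) :=
    mul_nonneg (Real.exp_nonneg _) (kingS2Inf_pos hm _).le
  have h := king_onePoint_lowerBound_le_gapNorm_pow (d := d) hm t
  calc (Real.exp (-kingS2Inf (d := d) m2 0) * kingS2Inf m2 ((Pi.single 0 1 : Fin (d + 1) → ℤ) + (t : ℤ) • (Pi.single 0 (1 : ℤ) : Fin (d + 1) → ℤ))) ^ ((t : ℝ)⁻¹)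
      ≤ (D.gapNorm ^ t) ^ ((t : ℝ)⁻¹) := Real.rpow_le_rpow ha0 h (by positivity)
    _ = D.gapNorm := by
        rw [← Real.rpow_natCast, ← Real.rpow_mul D.gapNorm_nonneg, mul_inv_cancel₀ ht0.ne', Real.rpow_one]

/-- ★★★ **THE GAP NORM OF KING's TRANSFER OPERATOR IS EXACTLY `e^{−√m²}`**: `‖T P_{Ω^⊥}‖ = e^{−√m²}`. [cite: King1986, Thm 2.1 (2.22)–(2.23) p.654, Thm 3.3 (3.6) p.656; GlimmJaffe1987, §6.1, §19.7] -/
theorem king_gapNorm_eq {m2 : ℝ} (hm : 0 < m2) :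
    (rpTransferData (king_isRPMeasureData (d := d) hm) (king_shift_nonneg hm)).gapNorm = Real.exp (-Real.sqrt m2) :=
  le_antisymm (king_hasMassGap hm).2 (king_exp_neg_le_gapNorm hm)

/-- ★★★ **THE MASS GAP OF KING's TRANSFER OPERATOR IS EXACTLY `√m²`** (the tree's `EReal`-valued `TransferData.massGap`). [cite: King1986, Thm 2.1 (2.22)–(2.23) p.654, Thm 3.3 (3.6) p.656; GlimmJaffe1987, §6.1] -/
theorem king_massGap_eq {m2 : ℝ} (hm : 0 < m2) :
    (rpTransferData (king_isRPMeasureData (d := d) hm) (king_shift_nonneg hm)).massGap = ((Real.sqrt m2 : ℝ) : EReal) := by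
  rw [TransferData.massGap, king_gapNorm_eq hm, if_neg (Real.exp_pos _).ne', Real.log_exp, neg_neg]

/-- ★★ `HasMassGap m′ ↔ 0 < m′ ≤ √m²`: the admissible gaps of King's transfer operator are exactly the rates up to the mass. [cite: GlimmJaffe1987, §6.1] -/
theorem king_hasMassGap_iff {m2 : ℝ} (hm : 0 < m2) (m' : ℝ) :
    (rpTransferData (king_isRPMeasureData (d := d) hm) (king_shift_nonneg hm)).HasMassGap m' ↔ 0 < m' ∧ m' ≤ Real.sqrt m2 := by
  rw [TransferData.HasMassGap, king_gapNorm_eq hm, Real.exp_le_exp, neg_le_neg_iff]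

end Summit.QuantumFields.YangMills.BalabanUVNodes.N15KingModelRung.InfiniteVolume
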